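import Mathlib
import Literature.AlgebraicGeometry.RelativeSpec.FiniteGroupQuotientGluedProperties
import Literature.AlgebraicGeometry.RelativeSpec.GeometricQuotientRecognition
import Literature.AlgebraicGeometry.Ramification.InertiaNormalSylowBaseChange
import Summits.ResolutionOfSingularities.ResolutionOfSingularities.Theorems.WildQuotientsGaloisQuotientEtaleGlued
import Summits.ResolutionOfSingularities.ResolutionOfSingularities.Theorems.WildQuotientsGaloisQuotientStableCover
import Summits.ResolutionOfSingularities.ResolutionOfSingularities.Theorems.WildQuotientsWildQuotientResolutionGaloisTorsorFreeLocus
import HarnessLib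

/-!
# Phase 0 with a NORMAL model over the quotient, for the crux data, conditional on Abbes–Saito 2011 Prop. 2.22
# (crux `WildQuotients.WildQuotientResolution`, stub `stub_phaseZeroHighDim`)

Crux stmt-ResolutionOfSingularities-15640 (`WildQuotientResolution`), line `Sketch`, registered stub
`stub_phaseZeroHighDim` ("Sylow separation": a `G`-equivariant REGULAR model all of whose inertia groups are
p-closed). This file instantiates ✓`GaloisTorsorFreeLocus.exists_admissibleBlowup_forall_hasNormalSylow` on
the crux's own data and records the resulting CONDITIONAL form of Phase 0 with a normal model:

**Theorem** (`exists_admissibleBlowup_glued_forall_hasNormalSylow`). Assume the typed named fact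
`AbbesSaito2011_inertiaNormalSylow_after_admissibleBlowup` (AS2011 Prop. 2.22). Let `k` be a field of
characteristic `ℓ`, `X → Spec k` separated and locally of finite type with `X` integral, `ρ` a FAITHFUL
action of the finite group `G` on `X` over `k` covered by `G`-stable affine opens (for the crux: `q⁻¹U`,
`exists_stableAffineOpens_mem`), with NORMAL glued quotient `π : X → X/G` (the tree's `ActionOver.glued`,
`gluedMk`; normal when `X` is, ✓`QuotientModelNormal.isIntegrallyClosed_stalk_glued_of_stalk`). Then for
every DENSE open `W ⊆ X/G` over which `π` is étale (such `W` exist by faithfulness,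
✓`exists_dense_etale_gluedMk_morphismRestrict`) there are a `W`-admissible blow-up `φ : Q′ → X/G` and the
lift `f′ : π⁻¹W → Q′` of `π` such that EVERY inertia group of the (restricted) action of `G` on the
integral closure `f′.normalization` of `Q′` in `π⁻¹W` has a normal Sylow `ℓ`-subgroup.

The integral closure `f′.normalization` is the candidate NORMAL Phase-0 model: it is `G`-equivariantly
birational to `X′` (both contain the dense `G`-stable open `q_G⁻¹W`), and what separates it from the
registered stub is (R2) the equivariant proper birational morphism to `X′` (universal property of relative
normalisation + finiteness of normalisation) and (R3) REGULARITY — an equivariant regular model dominating it,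
i.e. equivariant principalisation, open in dimension `≥ 4` (memo PHASE0-AS2011-v2.md on the item).

Assembly: the glued quotient over the affine base `Spec k` is an affine geometric quotient
(★`isGeometricQuotient_gluedMk`), integral (★`isIntegral_glued`), locally of finite type
(★`locallyOfFiniteType_gluedDesc_base`); then ✓`GaloisTorsorFreeLocus.exists_admissibleBlowup_forall_hasNormalSylow`.
`exists_stableAffineOpens_mem`: the crux's `q : X′ → X₁` affine and `G`-invariant gives Mumford's cover by
the `G`-stable affine opens `q⁻¹U` (✓`isAffineHom_of_isAffine_of_isSeparated`).

[OURS · crux stmt-ResolutionOfSingularities-15640 · helper toward `stub_phaseZeroHighDim`, CONDITIONAL on the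
named fact AS2011 Prop. 2.22; counted 0; AI-level work, weaker than expert review.]
-/

-- single-problem summit: the doubled namespace component `ResolutionOfSingularities` is forced
set_option linter.dupNamespace false

noncomputable section

open CategoryTheory CategoryTheory.Limits AlgebraicGeometry TopologicalSpace
open Literature.AlgebraicGeometry.Ramification Literature.AlgebraicGeometry.RelativeSpec
open Literature.AlgebraicGeometry.Resolution

namespace Summit.ResolutionOfSingularities.ResolutionOfSingularities.Theorems.WildQuotientResolution.QuotientPhaseZeroNormal

set_option backward.isDefEq.respectTransparency false

set_option maxHeartbeats 800000 in
/-- **Phase 0 with a normal model over the glued quotient, conditional on AS2011 Prop. 2.22.** For a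
FAITHFUL action `ρ` of the finite group `G` on the integral `X` over a field `k` (`s : X → Spec k`
separated, locally of finite type), covered by `G`-stable affine opens (Mumford's hypothesis `hcov`, e.g.
`X` affine over an invariant separated base), whose glued quotient `X/G` (the tree's `ActionOver.glued`)
is NORMAL: for every dense open `W ⊆ X/G` over which the quotient map `π = gluedMk` is étale — such `W`
exist, ✓`exists_dense_etale_gluedMk_morphismRestrict` — there are a `W`-admissible blow-up `φ : Q′ → X/G`
(finite-type ideal, support off `W`), the lift `f′ : π⁻¹W → Q′` (`f′ ≫ φ = π|_W ≫ (W ↪ X/G)`, equivariant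
for the restricted action), and p-closed inertia at EVERY point of the integral closure `f′.normalization`
of `Q′` in `π⁻¹W`. [cite: AbbesSaito2011, Prop. 2.22 (NS4), 2.3, Def. 2.12]
[cite: SGA1, Exp. V, Prop. 1.8, 2.6] [cite: MumfordAV1970, §7 Thm. p. 66] -/
theorem exists_admissibleBlowup_glued_forall_hasNormalSylow
    (hAS : AbbesSaito2011_inertiaNormalSylow_after_admissibleBlowup.{0})
    (ℓ : ℕ) [Fact ℓ.Prime] {k : Type} [Field k] [CharP k ℓ]
    {X : Scheme.{0}} (s : X ⟶ Spec (.of k)) [IsSeparated s] [LocallyOfFiniteType s] [IsIntegral X]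
    {G : Type} [Group G] [Finite G] (ρ : ActionOver s G) (hfaith : Function.Injective ρ.aut)
    (hcov : ∀ x : X, ∃ O : ρ.StableAffineOpens, x ∈ O.1)
    (hnorm : ∀ y : ρ.glued, IsIntegrallyClosed (ρ.glued.presheaf.stalk y))
    (W : ρ.glued.Opens) (hWd : Dense (W : Set ρ.glued)) [Etale (ρ.gluedMk hcov ∣_ W)] :
    ∃ (ρW : G →* Aut ((ρ.gluedMk hcov ⁻¹ᵁ W : X.Opens) : Scheme.{0}))
      (_ : ∀ g : G, (ρW g).hom ≫ (ρ.gluedMk hcov ⁻¹ᵁ W).ι = (ρ.gluedMk hcov ⁻¹ᵁ W).ι ≫ (ρ.aut g).hom)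
      (Q' : Scheme.{0}) (φ : Q' ⟶ ρ.glued) (I : ρ.glued.IdealSheafData),
        IsBlowup φ I ∧ (∀ U : ρ.glued.affineOpens, (I.ideal U).FG) ∧
        Disjoint (W : Set ρ.glued) (I.support : Set ρ.glued) ∧
        ∃ (f' : ((ρ.gluedMk hcov ⁻¹ᵁ W : X.Opens) : Scheme.{0}) ⟶ Q') (_ : QuasiCompact f')
          (_ : QuasiSeparated f') (hρ' : ∀ g, (ρW g).hom ≫ f' = f'),
          f' ≫ φ = (ρ.gluedMk hcov ∣_ W) ≫ W.ι ∧
            ∀ y : ↥f'.normalization, HasNormalSylow ℓ (inertiaSubgroup (normalizationAction f' ρW hρ') y) := by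
  classical
  haveI : Fintype G := Fintype.ofFinite G
  -- the glued quotient is an affine geometric quotient, integral, of finite type over `k`
  have hq : ρ.IsGeometricQuotient (ρ.gluedMk hcov) := ρ.isGeometricQuotient_gluedMk hcov
  haveI : IsIntegral ρ.glued := ρ.isIntegral_glued hcov
  haveI : LocallyOfFiniteType (ρ.gluedDesc s ρ.aut_comp) := ρ.locallyOfFiniteType_gluedDesc_base
  have hN : ∀ y : ρ.glued, IsDomain (ρ.glued.presheaf.stalk y) ∧
      IsIntegrallyClosed (ρ.glued.presheaf.stalk y) := fun y => ⟨inferInstance, hnorm y⟩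
  -- Abbes–Saito over the étale locus
  obtain ⟨Q', φ, I, hb, hfg, hdisj, f', hqc, hqs, hρ', hf', hNS⟩ :=
    GaloisTorsorFreeLocus.exists_admissibleBlowup_forall_hasNormalSylow hAS hq hfaith W
      (ρ.gluedDesc s ρ.aut_comp) inferInstance hN hWd
  exact ⟨(ρ.restrict (ρ.gluedMk hcov ⁻¹ᵁ W) (hq.preimage_stable W)).aut,
    fun g => by rw [ActionOver.restrict_aut_hom, ActionOver.restrictHom_ι],
    Q', φ, I, hb, hfg, hdisj, f', hqc, hqs, hρ', hf', hNS⟩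

/-- **The crux's data satisfy Mumford's hypothesis over `Spec k`**: for `q : X′ → X₁` affine and
`G`-invariant with `X₁` separated over `k`, every point of `X′` lies in a `G`-stable open affine over
`Spec k` — namely `q⁻¹U` for an affine open `U ∋ q x` of `X₁`. So the glued quotient `X′/G` over `k` of
the action `⟨ρ, _⟩ : ActionOver (q ≫ f) G` exists with all the properties used above (and, for `X′`
normal, it is normal: ✓`QuotientModelNormal.isIntegrallyClosed_stalk_glued_of_stalk`).
[cite: MumfordAV1970, §7 Thm. p. 66] [cite: SGA1, Exp. V, Prop. 1.8] -/
theorem exists_stableAffineOpens_mem {k : Type} [Field k] {X' X₁ : Scheme.{0}} (f : X₁ ⟶ Spec (.of k))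
    (q : X' ⟶ X₁) [IsSeparated f] [IsAffineHom q] {G : Type} [Group G] (ρ : G →* Aut X')
    (hρ : ∀ g : G, (ρ g).hom ≫ q = q) (x : X') :
    ∃ O : (⟨ρ, fun g => by rw [← Category.assoc, hρ g]⟩ : ActionOver (q ≫ f) G).StableAffineOpens,
      x ∈ O.1 := by
  haveI : X₁.IsSeparated := ⟨by rw [← terminal.comp_from f]; infer_instance⟩
  haveI : X'.IsSeparated := ⟨by rw [← terminal.comp_from (q ≫ f)]; infer_instance⟩
  obtain ⟨U, hU, hxU, -⟩ :=
    exists_isAffineOpen_mem_and_subset (X := X₁) (x := q.base x) (U := ⊤) (Opens.mem_top _)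
  haveI : IsAffine ((q ⁻¹ᵁ U : X'.Opens) : Scheme.{0}) := hU.preimage q
  exact ⟨⟨q ⁻¹ᵁ U, fun g => by rw [← Scheme.Hom.comp_preimage, hρ g],
    isAffineHom_of_isAffine_of_isSeparated _⟩, hxU⟩

end Summit.ResolutionOfSingularities.ResolutionOfSingularities.Theorems.WildQuotientResolution.QuotientPhaseZeroNormal

end
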